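import Summits.BirchSwinnertonDyer.BirchSwinnertonDyer.Theorems.KatoDescentPotSupersingularSmallImageEulerSystemBoundOffP
import Summits.BirchSwinnertonDyer.BirchSwinnertonDyer.Theorems.ErratumRoadFiveNonSurjCornerMuCore
import Literature.NumberTheory.EllipticCurves.KatoFineSelmerFiniteProofs
import HarnessLib

/-!
# Kato's Λ-adic divisibility `char X₀(W/ℚ_∞) ∣ char(𝐇¹_Γ/Λs)` on the IRREDUCIBLE NON-SURJECTIVE (U₀-ns) non-CM
# rows, from a `p`-indivisible genuine Euler-system class — modulo {Kato 13.4 fact, Serre III.7.9 (a)} only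

Seat `bsd-potss-rkm` g15 (prover; cell `bsd-potss`).  Companion of
`Theorems/KatoDescentPotSupersingularSmallImageEulerSystemBoundOffP.lean` (the REDUCIBLE rows of crux M, item 19196);
this file serves the U₀-ns rows of K9 / K8-t′ (items stmt-BirchSwinnertonDyer-19189 `WildUpperNonsurjTower`, its
tame twin, and the (A)-asides 19386 / 19942 / 19916) as a HELPER (`--supports … --as helper`; closes nothing).
HONEST FRAMING (cell): BSD is not proved by any of this; nothing is booked; no item closes.

WHAT.  On a row with `E[p]` IRREDUCIBLE but `ρ̄_{E,p}` NOT onto (odd `p`, `W` globally minimal, non-CM), Kato's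
(12.5.2) fails and his Thm. 12.5 (4) gives no integral divisibility («uncontrolled index», the `why_might_fail` of
19189 / 19197).  Two kernel theorems of the tree close the gap Λ-adically, given ONE genuine Λ-adic Euler-system class
`s ∈ 𝐇¹_Γ(T_pW)` NOT divisible by `p`:
* at `𝔭 = (p)`: the K6 core `CoreAssembly.coreOdd_anyReduction_holds` at ANY reduction type (cells `bsd-stepL` /
  `bsd-ssimc`; as in `SmallImageSignedMuTransfer.fineSelmerDual_lengthAt_augIdealP_eq_zero_of_eulerSystemClass`):
  `Sel₀(ℚ_∞, E[p^∞])[p]` finite ⇒ `X₀/pX₀` finite ⇒ `X₀` finitely generated, torsion, `ℓ_(p)(X₀) = 0`;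
* at `𝔭 ∌ p`: `SmallImageEulerSystemBoundOffP.lengthAt_fineSelmerDual_le_of_isEulerSystemClass_of_not_hasCM` (this
  seat): Kato Thm. 13.4 (2) with hypothesis (v) from Serre's `p`-adic open image.
Hence `charIdeal_le_charIdeal_fineSelmerDual_of_irreducible_of_not_surjective`:
**`char_Λ(𝐇¹_Γ(T_pW)/Λs) ⊆ char_Λ X₀(W/ℚ_∞)`** for every such `s` with `𝐇¹_Γ/Λs` torsion — modulo {`thm13_4_…`,
`serre_adicImage_…`} and NOTHING ELSE (no Ferrero–Washington, no Lim: the `μ`-part is the Euler-system argument itself).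
The `p`-indivisibility `s ∉ p𝐇¹` is the genuine input (for Kato's zeta class it is «`μ` of the zeta ideal `= 0`»,
cf. `Kato2004.exists_isEulerSystemClass_not_mem` in the ordinary package); it is displayed, not supplied.
References: [Kato2004Asterisque] Thm. 12.5 (4) (p. 222), Thm. 13.4 (p. 226), §13.8; [SilvermanAEC2009] Thm. III.7.9 (a);
[MazurRubin2004] §5.3; tree files above and `Kim2025/FineOneSidedDivisibility.lean`.
-/

-- the summit and its single problem are both named `BirchSwinnertonDyer` (registry layout D-0017)
set_option linter.dupNamespace false
set_option autoImplicit false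

noncomputable section

open Field WeierstrassCurve
open Literature.NumberTheory.GaloisRepresentations Literature.NumberTheory.EllipticCurves
open Literature.NumberTheory.EllipticCurves.Kato2004

namespace Summit.BirchSwinnertonDyer.BirchSwinnertonDyer.Theorems.SmallImageEulerSystemBoundOffP

/-- **Kato's divisibility on the U₀-ns rows from a `p`-indivisible Euler-system class.**  For `W/ℚ` globally
minimal, non-CM, `p ≠ 2`, `E[p]` IRREDUCIBLE and `ρ̄_{E,p}` NOT surjective, the cyclotomic `(κ, γ)`, pinned `I`, any
dual fine Selmer datum `Y`, and a genuine Λ-adic Euler-system class `s ∈ 𝐇¹_Γ(T_pW)` with `s ∉ p𝐇¹_Γ` and `𝐇¹_Γ/Λs`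
torsion: `char_Λ(𝐇¹_Γ/Λs) ⊆ char_Λ X₀(W/ℚ_∞)`.  Modulo {Kato Thm. 13.4 fact, Serre's open image} only: the
`(p)`-part is the tree's kernel `μ`-transfer (`CoreAssembly.coreOdd_anyReduction_holds`), the
off-`p` part is 13.4 (2) with (v) from Serre. [cite: Kato2004Asterisque, Thm. 13.4 (2) (p. 226) and Thm. 12.5 (4) (p. 222)]
[cite: SilvermanAEC2009, Thm. III.7.9 (a)] -/
theorem charIdeal_le_charIdeal_fineSelmerDual_of_irreducible_of_not_surjective
    (h134 : thm13_4_lengthAt_fineSelmerDual_le_of_isEulerSystemClass)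
    (hSerre : serre_adicImage_contains_congruenceSubgroup)
    (W : WeierstrassCurve ℚ) [W.IsElliptic] [W.IsGloballyMinimal] (p : ℕ) [Fact p.Prime]
    [ContinuousSMul ℤ_[p] (W.tateModule p)] [Module.Free ℤ_[p] (W.tateModule p)]
    [Module.Finite ℤ_[p] (W.tateModule p)]
    (κ : ZpExtension ℚ p) (γ : absoluteGaloisGroup ℚ) (hp : p ≠ 2) (hκ : κ.IsCyclotomic)
    (hγ : κ.IsTopGenerator γ) (hCM : ¬ W.HasCM) (hirr : W.HasIrreducibleModPGaloisRep p)
    (hns : ¬ W.HasSurjectiveModNGaloisRep (p : ℤ))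
    (I : IwasawaH1Data W p κ γ) (Y : W.FineSelmerDualData κ γ) (s : I.H)
    (hs : IsEulerSystemClass W p κ γ I s)
    (hsp : s ∉ IwasawaAlgebra.augIdealP p • (⊤ : Submodule (IwasawaAlgebra p) I.H))
    (htors : Module.IsTorsion (IwasawaAlgebra p) (I.H ⧸ Submodule.span (IwasawaAlgebra p) {s})) :
    Module.charIdeal (IwasawaAlgebra p) (I.H ⧸ Submodule.span (IwasawaAlgebra p) {s}) ≤
      Module.charIdeal (IwasawaAlgebra p) Y.X := by
  have hs0 : s ≠ 0 := by
    rintro rfl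
    exact hsp (Submodule.zero_mem _)
  -- `(p)`-part: the kernel μ-transfer at any reduction type (K6 core ⇒ `Sel₀[p]` finite ⇒ `X₀/pX₀` finite)
  obtain ⟨J, hJ⟩ := Rank1Residual.CoreAssembly.coreOdd_anyReduction_holds W p κ γ I hp hirr hns hκ hγ ⟨s, hs, hsp⟩
  have hfin := W.finite_fineSelmerInfty_pTorsion_of_forall_iterate_eq_zero κ hγ hJ
  haveI : Module.Finite (IwasawaAlgebra p) Y.X := Y.module_finite_of_finite_pTorsion hγ hfin
  haveI : Finite (Y.X ⧸ (IwasawaAlgebra.augIdealP p • (⊤ : Submodule (IwasawaAlgebra p) Y.X))) :=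
    Y.finite_quotient_augIdealP_of_finite_pTorsion hfin
  have hYtors : Module.IsTorsion (IwasawaAlgebra p) Y.X :=
    IwasawaModuleFinitePadicInt.isTorsion_of_finite_quotient_augIdealP p Y.X inferInstance
  haveI : Module.Finite (IwasawaAlgebra p) I.H := IwasawaH1Data.module_finite_of_isCyclotomic hκ hγ I
  -- lengths at every height-one prime
  refine Kim2025.charIdeal_le_charIdeal_of_lengthAt_le htors hYtors fun 𝔭 h𝔭 ↦ ?_
  by_cases hp𝔭 : PowerSeries.C (p : ℤ_[p]) ∈ 𝔭.asIdeal
  · have h0 := Rank1Residual.KatoMuSkeleton.lengthAt_eq_zero_of_finite_quotient_p (M := Y.X) 𝔭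
      (eq_augIdealP_of_height_eq_one_of_C_mem 𝔭 h𝔭 hp𝔭)
    simp [h0]
  · exact lengthAt_fineSelmerDual_le_of_isEulerSystemClass_of_not_hasCM h134 hSerre W p κ γ hp hκ hγ hCM
      I Y s hs hs0 𝔭 h𝔭 hp𝔭

end Summit.BirchSwinnertonDyer.BirchSwinnertonDyer.Theorems.SmallImageEulerSystemBoundOffP

end
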